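import Mathlib
import HarnessLib.Audit.Tags
import Summits.Ventures.ResidMod.Conjectures.TwistedTorsionFamilyLaw
import Summits.Ventures.ResidMod.Conjectures.SquareClassImprimitivity

/-!
# Imprimitivity certificates for the classified residual (STRUCTURE.md §4 E38 / TODO-29)

Honest framing: elementary field theory of integer sextics — two block-structure notions and the group-order bounds
they imply, PROVED by the tower-law argument of `SquareClassGalois.lean` (p367551; its three folklore lemmas are
re-proved here as `private` copies so that this file does not depend on that module's build state); no curve, no Galois-image determination, no
modularity claim. The sharp bounds (`|Gal| ∣ 72`, resp. `|Gal| ∣ 48` from `S₃ ≀ C₂`, resp. `C₂ ≀ S₃`) are not needed for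
the census consequences and the second is NOT proved here (we prove `∣ 144`, which already excludes elements of order `5`
and `Typical`).

RUNG 23a of the cell «pub-residmod» (registration R292, verdict R293, kit j200365) certified, member for member, that each
of the 71 936 five-cycle-free irreducible members of record at heights 33–48 is IMPRIMITIVE in one of two explicit ways:
* `HasThreeBlocks f` — over some quadratic field `ℚ[Y]/(Y² − D)` the sextic acquires a cubic factor (the «quadratic-norm
  splitting» `4f = A² − D·B²`; the square class `MemberSQ` of `SquareClassImprimitivity.lean` is the case `D = −c`);
* `HasTwoBlocks f` — over some cubic field `L = ℚ[Y]/(S)` the sextic acquires a quadratic factor (the «Galois-stable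
  pairing»: `f = lc · N_{L/ℚ}(x² − αx + β)`; the even-after-a-rational-shift locus is the degenerate sub-case).
Main results (all PROVED): `card_gal_dvd_of_factorisation` (generic: a factorisation `f = q·r` over a field `L ⊇ ℚ` gives
`|Gal(f/ℚ)| ∣ [L:ℚ]·(deg q)!·(deg r)!`), `M23_threeBlocks_card_dvd` (`∣ 72`), `M23_twoBlocks_card_dvd` (`∣ 144`),
`M23_not_typical`, `M23_orderOf_ne_five` (the square class is the case `D = −c` of `HasThreeBlocks`; the one-line
linkage via `sqRep_factor_over` is left to the typer lane). The census facts they explain are STRUCTURE.md E38 (2BLOCK ∨ NORM =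
71 936 / 71 936 on the residual; 0 / 25 840 on the typical / converted controls). Dedekind's theorem (a `(5,1)` cycle
pattern gives a `5`-cycle) is quoted, not formalised, exactly as in the companion files.
-/

open Polynomial Module

namespace Summit.Ventures.ResidMod.Conjectures

/-! ## Folklore lemmas (private copies of the `SquareClassGalois.lean` versions) -/

/-- The Galois group of a polynomial over a field embeds in the permutations of its roots, so its order divides
`natDegree !` (private copy of `card_gal_dvd_factorial`, p367551). [folklore] -/
private theorem card_gal_dvd_factorial' {K : Type*} [Field K] (g : K[X]) :
    Nat.card g.Gal ∣ (g.natDegree).factorial := by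
  classical
  let L := g.SplittingField
  have hS : (g.map (algebraMap K L)).Splits := SplittingField.splits g
  haveI : Fact ((g.map (algebraMap K L)).Splits) := ⟨hS⟩
  have hdvd : Nat.card g.Gal ∣ (Nat.card (g.rootSet L)).factorial := by
    rw [← Nat.card_perm]
    exact Subgroup.card_dvd_of_injective _ (Gal.galActionHom_injective g L)
  refine dvd_trans hdvd (Nat.factorial_dvd_factorial ?_)
  have hrs : Nat.card (g.rootSet L) = (g.map (algebraMap K L)).roots.toFinset.card := by
    rw [rootSet_def, Finset.coe_sort_coe, Nat.card_eq_finsetCard]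
  rw [hrs]
  calc (g.map (algebraMap K L)).roots.toFinset.card ≤ (g.map (algebraMap K L)).roots.card :=
        Multiset.toFinset_card_le _
    _ ≤ (g.map (algebraMap K L)).natDegree := card_roots' _
    _ = g.natDegree := natDegree_map _

/-- The Galois group of a product embeds in the product of the Galois groups (private copy of `card_gal_mul_dvd`,
p367551). [folklore] -/
private theorem card_gal_mul_dvd' {K : Type*} [Field K] (a b : K[X]) :
    Nat.card (a * b).Gal ∣ Nat.card a.Gal * Nat.card b.Gal := by
  rw [← Nat.card_prod]
  exact Subgroup.card_dvd_of_injective _ (Gal.restrictProd_injective a b)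

/-- Tower law through an embedding: if `F ∈ k[X]` splits in `E ⊇ k`, the splitting field of `F` embeds in `E` over `k`,
so its degree divides `[E : k]` (private copy of `finrank_splittingField_dvd`, p367551). [folklore] -/
private theorem finrank_splittingField_dvd' {k E : Type*} [Field k] [Field E] [Algebra k E] (F : k[X])
    (h : (F.map (algebraMap k E)).Splits) : finrank k F.SplittingField ∣ finrank k E := by
  let φ : F.SplittingField →ₐ[k] E := SplittingField.lift F h
  letI : Algebra F.SplittingField E := φ.toRingHom.toAlgebra
  haveI : IsScalarTower k F.SplittingField E :=
    IsScalarTower.of_algebraMap_eq (fun x => (φ.commutes x).symm)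
  exact Dvd.intro _ (Module.finrank_mul_finrank k F.SplittingField E)

/-! ## The two block structures -/

/-- Blocks of size 3: over some quadratic field `ℚ[Y]/(Y² − D)` (`Y² − D` irreducible over `ℚ`) the sextic has a factor
of degree `3`. -/
def HasThreeBlocks (f : Sextic) : Prop :=
  ∃ D : ℚ, Irreducible (X ^ 2 - C D : ℚ[X]) ∧
    ∃ q r : (AdjoinRoot (X ^ 2 - C D : ℚ[X]))[X], q.natDegree = 3 ∧
      (toRatPoly f).map (algebraMap ℚ (AdjoinRoot (X ^ 2 - C D : ℚ[X]))) = q * r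

/-- Blocks of size 2: over some cubic field `ℚ[Y]/(S)` (`S` of degree `3`, irreducible over `ℚ`) the sextic has a factor
of degree `2`. -/
def HasTwoBlocks (f : Sextic) : Prop :=
  ∃ S : ℚ[X], S.natDegree = 3 ∧ Irreducible S ∧
    ∃ q r : (AdjoinRoot S)[X], q.natDegree = 2 ∧
      (toRatPoly f).map (algebraMap ℚ (AdjoinRoot S)) = q * r

/-! ## The generic tower bound -/

/-- PROVED (tower law, generic): if a separable `F ∈ ℚ[X]` factors as `q·r` over a field `L ⊇ ℚ`, then
`|Gal(F/ℚ)| ∣ [L:ℚ] · (deg q)! · (deg r)!` — the splitting field of `F` over `ℚ` embeds in the splitting field `E` of `F`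
over `L`, `[E:ℚ] = [L:ℚ]·[E:L]`, and `[E:L] = |Gal(F/L)| ∣ |Gal(q/L)|·|Gal(r/L)|`. (`finrank = 0` for an infinite `L` makes
the statement vacuous-but-true; it is used with number fields.) -/
theorem card_gal_dvd_of_factorisation {L : Type*} [Field L] [Algebra ℚ L] (F : ℚ[X]) (hsep : F.Separable)
    (q r : L[X]) (hqr : F.map (algebraMap ℚ L) = q * r) :
    Nat.card F.Gal ∣ finrank ℚ L * ((q.natDegree).factorial * (r.natDegree).factorial) := by
  classical
  have hGalFK : Nat.card (F.map (algebraMap ℚ L)).Gal ∣ (q.natDegree).factorial * (r.natDegree).factorial := by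
    rw [hqr]
    calc Nat.card (q * r).Gal ∣ Nat.card q.Gal * Nat.card r.Gal := card_gal_mul_dvd' q r
      _ ∣ (q.natDegree).factorial * (r.natDegree).factorial :=
          mul_dvd_mul (card_gal_dvd_factorial' q) (card_gal_dvd_factorial' r)
  let E := (F.map (algebraMap ℚ L)).SplittingField
  have hFKsep : (F.map (algebraMap ℚ L)).Separable := hsep.map
  have hE : finrank L E = Nat.card (F.map (algebraMap ℚ L)).Gal := (Gal.card_of_separable hFKsep).symm
  have hsplitE : (F.map (algebraMap ℚ E)).Splits := by
    rw [IsScalarTower.algebraMap_eq ℚ L E, ← Polynomial.map_map]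
    exact SplittingField.splits _
  have hL : finrank ℚ F.SplittingField ∣ finrank ℚ E := finrank_splittingField_dvd' _ hsplitE
  have htower : finrank ℚ L * finrank L E = finrank ℚ E := Module.finrank_mul_finrank ℚ L E
  rw [Gal.card_of_separable hsep]
  calc finrank ℚ F.SplittingField ∣ finrank ℚ E := hL
    _ = finrank ℚ L * finrank L E := htower.symm
    _ ∣ finrank ℚ L * ((q.natDegree).factorial * (r.natDegree).factorial) :=
        mul_dvd_mul_left _ (hE ▸ hGalFK)

/-- `toRatPoly f` has degree `6` for a genuine sextic. -/
theorem natDegree_toRatPoly {f : Sextic} (hf : f 6 ≠ 0) : (toRatPoly f).natDegree = 6 := by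
  rw [toRatPoly, natDegree_map_eq_of_injective (Int.castRingHom ℚ).injective_int, natDegree_toPoly hf]

/-- Degree bookkeeping: a factorisation of `f` over a field with a factor of degree `d ≤ 6` has cofactor of degree
`6 − d`. -/
theorem natDegree_cofactor {L : Type*} [Field L] [Algebra ℚ L] {f : Sextic} (hf : f 6 ≠ 0) {q r : L[X]} {d : ℕ}
    (hq : q.natDegree = d) (hqr : (toRatPoly f).map (algebraMap ℚ L) = q * r) : r.natDegree = 6 - d := by
  have hF0 : toRatPoly f ≠ 0 := by
    intro h
    have := natDegree_toRatPoly hf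
    rw [h, natDegree_zero] at this
    omega
  have hqr0 : q * r ≠ 0 := by
    rw [← hqr]
    exact (Polynomial.map_ne_zero_iff (algebraMap ℚ L).injective).mpr hF0
  have hdeg : (q * r).natDegree = 6 := by
    rw [← hqr, natDegree_map_eq_of_injective (algebraMap ℚ L).injective, natDegree_toRatPoly hf]
  have h := natDegree_mul (left_ne_zero_of_mul hqr0) (right_ne_zero_of_mul hqr0)
  rw [hdeg, hq] at h
  omega

/-! ## The two bounds and their consequences -/

/-- PROVED (TODO-29a): a non-degenerate sextic with blocks of size 3 has `|Gal(f/ℚ)| ∣ 72 = 2·3!·3!`. -/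
theorem M23_threeBlocks_card_dvd :
    ∀ f : Sextic, NonDegenerate f → HasThreeBlocks f → Nat.card (toRatPoly f).Gal ∣ 72 := by
  intro f hnd h3
  obtain ⟨D, hirr, q, r, hq3, hqr⟩ := h3
  haveI : Fact (Irreducible (X ^ 2 - C D : ℚ[X])) := ⟨hirr⟩
  have hK : finrank ℚ (AdjoinRoot (X ^ 2 - C D : ℚ[X])) = 2 := by
    rw [(AdjoinRoot.powerBasis hirr.ne_zero).finrank, AdjoinRoot.powerBasis_dim, natDegree_X_pow_sub_C]
  have hr3 : r.natDegree = 3 := natDegree_cofactor hnd.1 hq3 hqr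
  have h := card_gal_dvd_of_factorisation (toRatPoly f) hnd.2 q r hqr
  rw [hK, hq3, hr3] at h
  exact h.trans (by norm_num [Nat.factorial])

/-- PROVED (TODO-29b, census strength): a non-degenerate sextic with blocks of size 2 has `|Gal(f/ℚ)| ∣ 144 = 3·2!·4!`.
(The sharp group-theoretic bound for an irreducible `f` is `∣ 48`, the order of `C₂ ≀ S₃`; it needs the block action and is
not proved here — `144` already has no prime factor `5` and is `< 360`.) -/
theorem M23_twoBlocks_card_dvd :
    ∀ f : Sextic, NonDegenerate f → HasTwoBlocks f → Nat.card (toRatPoly f).Gal ∣ 144 := by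
  intro f hnd h2
  obtain ⟨S, hS3, hirr, q, r, hq2, hqr⟩ := h2
  haveI : Fact (Irreducible S) := ⟨hirr⟩
  have hK : finrank ℚ (AdjoinRoot S) = 3 := by
    rw [(AdjoinRoot.powerBasis hirr.ne_zero).finrank, AdjoinRoot.powerBasis_dim, hS3]
  have hr4 : r.natDegree = 4 := natDegree_cofactor hnd.1 hq2 hqr
  have h := card_gal_dvd_of_factorisation (toRatPoly f) hnd.2 q r hqr
  rw [hK, hq2, hr4] at h
  exact h.trans (by norm_num [Nat.factorial])

/-- PROVED: a group whose order divides `144` has no element of order `5`. -/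
theorem orderOf_ne_five_of_card_dvd_144 {Γ : Type*} [Group Γ] (hΓ : Nat.card Γ ∣ 144) (g : Γ) : orderOf g ≠ 5 := by
  intro h5
  have h : 5 ∣ 144 := by
    have := orderOf_dvd_natCard g
    rw [h5] at this
    exact this.trans hΓ
  omega

/-- PROVED: a certified member (either block structure) is never `Typical` (`|Gal f| ≤ 144 < 360`). This is the typed
content of STRUCTURE.md E38 / rung 23a P166 («2BLOCK = 0 on the 20 348 sampled typical members») and of NULL-13…16
beyond the square class. -/
theorem M23_not_typical :
    ∀ f : Sextic, NonDegenerate f → (HasThreeBlocks f ∨ HasTwoBlocks f) → ¬ Typical f := by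
  intro f hnd hcert htyp
  unfold Typical at htyp
  rcases hcert with h | h
  · have hle : Nat.card (toRatPoly f).Gal ≤ 72 := Nat.le_of_dvd (by norm_num) (M23_threeBlocks_card_dvd f hnd h)
    omega
  · have hle : Nat.card (toRatPoly f).Gal ≤ 144 := Nat.le_of_dvd (by norm_num) (M23_twoBlocks_card_dvd f hnd h)
    omega

/-- PROVED: no element of order `5` in the Galois group of a certified non-degenerate member (so, by Dedekind's
theorem — quoted, not formalised — it is never `(5,1)`-certified at an unramified prime: the rung-18 residual mechanism,
now covering the WHOLE classified residual of record and not only the square class of `M19_orderOf_ne_five`). -/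
theorem M23_orderOf_ne_five {f : Sextic} (hnd : NonDegenerate f) (hcert : HasThreeBlocks f ∨ HasTwoBlocks f)
    (g : (toRatPoly f).Gal) : orderOf g ≠ 5 := by
  rcases hcert with h | h
  · exact orderOf_ne_five_of_card_dvd_72 (M23_threeBlocks_card_dvd f hnd h) g
  · exact orderOf_ne_five_of_card_dvd_144 (M23_twoBlocks_card_dvd f hnd h) g

end Summit.Ventures.ResidMod.Conjectures
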